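import Mathlib
import Summits.Ventures.PercRepro.TriangleCapSquareSum
import Summits.Ventures.PercRepro.TriangleCapRegularBipartite

/-!
# PercRepro — THE NESTED WITNESS AND THE EXACT BOTTOM OF EVERY DEEP SUB-BAND IN THE NESTED REGIME, EVERY `ℓ`
(p3, gen 55; part 300)

THE NESTED CONFIGURATION: `t = m D + r` pairs, the pair `i < t` joining the non-neighbour `1 + ⌊i/D⌋` (`lfNest`) to
the leaf `ℓ + 1 + (i mod D)` (`rfNest`) — `m` full columns of `D` pairs, one column of `r` pairs, and the conjugate
rows: the leaf `ℓ + 1 + b` carries `m + [b < r]` pairs.  Its collision count is `coll lf + coll rf =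
m D (D − 1) + r (r − 1) + r m (m + 1) + (D − r) m (m − 1) = sqNest m r D − 2 t` (`coll_lfNest`, `coll_rfNest`,
`coll_nest_add`), so its band value is `2 j = t (t + 1) − sqNest m r D = m (D − 1) (D (m − 1) + 2 r)`
(`two_mul_nest_bottom`).  With part 299's bound this is THE EXACT BOTTOM:

**THEOREM** (`nested_bottom_exact`, `1 ≤ D ≤ t ≤ D²`, `t ≤ ℓ D`, `2 t ≤ s`): on `ℓ + 1 + (s − t)` vertices every
graph of the band with every off-degree `≤ D` has `t (t + 1) ≤ 2 j + sqMax t D`, and the nested configuration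
attains `2 j = t (t + 1) − sqMax t D` with a non-neighbour of off-degree exactly `D`.  So the bottom of the deep
sub-band `u = t − D` is `C(t,2) − t (D − 1) + δ` with `2 δ = r (D − r) + r (m + 1)(D − m − 1) + (D − r) m (D − m)`
— the g54 conjecture's nested branch, for EVERY `ℓ ≥ ⌈t/D⌉`, the regime being exactly `t ≤ D²` (the conjugate
rows fit).  Axioms: standard.
-/

namespace PercRepro

namespace TriangleCap

namespace C047

open Finset

/-- The left ends of the nested configuration: the non-neighbour `1 + ⌊i/D⌋`. -/
def lfNest (D i : ℕ) : ℕ := 1 + i / D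

/-- The right ends of the nested configuration: the leaf `ℓ + 1 + (i mod D)`. -/
def rfNest (ℓ D i : ℕ) : ℕ := ℓ + 1 + i % D

/-- The class of the non-neighbour `1 + a`: the pairs `a D, …, a D + min(D, t − a D) − 1`. -/
theorem cls_lfNest (t D a : ℕ) (hD : 0 < D) :
    ((range t).filter (fun i => lfNest D i = 1 + a)).card = min D (t - a * D) := by
  have hset : (range t).filter (fun i => lfNest D i = 1 + a) = (range (min D (t - a * D))).image (fun j => a * D + j) := by
    ext i
    simp only [mem_filter, mem_range, mem_image]
    unfold lfNest
    constructor
    · rintro ⟨hi, hv⟩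
      have ha : i / D = a := by omega
      refine ⟨i % D, ?_, ?_⟩
      · have h1 := Nat.mod_lt i hD
        have h2 := Nat.div_add_mod i D
        rw [ha] at h2
        have h3 : i % D < t - a * D := by
          have : D * a = a * D := by ring
          omega
        exact lt_min h1 h3
      · have h2 := Nat.div_add_mod i D
        rw [ha] at h2
        have : D * a = a * D := by ring
        omega
    · rintro ⟨j, hj, rfl⟩
      have hj1 : j < D := lt_of_lt_of_le hj (min_le_left _ _)
      have hj2 : j < t - a * D := lt_of_lt_of_le hj (min_le_right _ _)
      obtain ⟨h1, -⟩ := div_mod_of_lt D a j hD hj1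
      refine ⟨by omega, ?_⟩
      rw [h1]
  rw [hset, card_image_of_injOn (fun x _ y _ h => Nat.add_left_cancel h), card_range]

/-- The class of the non-neighbour `1 + a` for `a < m`, `t = m D + r`: `D` pairs. -/
theorem cls_lfNest_full (m r D a : ℕ) (hD : 0 < D) (ha : a < m) :
    ((range (m * D + r)).filter (fun i => lfNest D i = 1 + a)).card = D := by
  rw [cls_lfNest _ _ _ hD]
  have : (a + 1) * D ≤ m * D := Nat.mul_le_mul_right D ha
  rw [Nat.succ_mul] at this
  omega

/-- The class of the non-neighbour `1 + m`, `t = m D + r`, `r < D`: the `r` pairs of the last column. -/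
theorem cls_lfNest_last (m r D : ℕ) (hD : 0 < D) (hr : r < D) :
    ((range (m * D + r)).filter (fun i => lfNest D i = 1 + m)).card = r := by
  rw [cls_lfNest _ _ _ hD]
  omega

/-- The class of the leaf `ℓ + 1 + b` (`b < D`): `t / D + [b < t mod D]` pairs. -/
theorem cls_rfNest (t ℓ D b : ℕ) (hD : 0 < D) (hb : b < D) :
    ((range t).filter (fun i => rfNest ℓ D i = ℓ + 1 + b)).card = t / D + (if b < t % D then 1 else 0) := by
  have hset : (range t).filter (fun i => rfNest ℓ D i = ℓ + 1 + b) =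
      (range (t / D + (if b < t % D then 1 else 0))).image (fun a => a * D + b) := by
    ext i
    simp only [mem_filter, mem_range, mem_image]
    unfold rfNest
    constructor
    · rintro ⟨hi, hv⟩
      have hb' : i % D = b := by omega
      refine ⟨i / D, ?_, ?_⟩
      · have h1 := Nat.div_add_mod i D
        have h2 := Nat.div_add_mod t D
        have h3 : i / D ≤ t / D := Nat.div_le_div_right (le_of_lt hi)
        rcases Nat.lt_or_ge (i / D) (t / D) with hlt | hge
        · split_ifs <;> omega
        · have heq : i / D = t / D := le_antisymm h3 hge
          rw [heq] at h1
          have hbt : b < t % D := by omega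
          rw [if_pos hbt]
          omega
      · have h1 := Nat.div_add_mod i D
        rw [hb'] at h1
        have : D * (i / D) = i / D * D := by ring
        omega
    · rintro ⟨a, ha, rfl⟩
      obtain ⟨h1, h2⟩ := div_mod_of_lt D a b hD hb
      refine ⟨?_, by rw [h2]⟩
      have ht := Nat.div_add_mod t D
      split_ifs at ha with hbt
      · rcases Nat.lt_or_ge a (t / D) with hlt | hge
        · have : (a + 1) * D ≤ t / D * D := Nat.mul_le_mul_right D hlt
          rw [Nat.succ_mul] at this
          have : D * (t / D) = t / D * D := by ring
          omega
        · have heq : a = t / D := by omega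
          rw [heq]
          have : D * (t / D) = t / D * D := by ring
          omega
      · have : (a + 1) * D ≤ t / D * D := Nat.mul_le_mul_right D ha
        rw [Nat.succ_mul] at this
        have : D * (t / D) = t / D * D := by ring
        omega
  rw [hset, card_image_of_injOn (fun x _ y _ h => Nat.eq_of_mul_eq_mul_right hD (Nat.add_right_cancel h)), card_range]

/-- The bounds of `lfNest`: `1 ≤ lfNest i ≤ ℓ` for `i < t ≤ ℓ D`. -/
theorem lfNest_bounds (t ℓ D i : ℕ) (hD : 0 < D) (htℓ : t ≤ ℓ * D) (hi : i < t) :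
    1 ≤ lfNest D i ∧ lfNest D i ≤ ℓ := by
  unfold lfNest
  have : i / D < ℓ := by
    rw [Nat.div_lt_iff_lt_mul hD]
    omega
  obtain ⟨q, hq⟩ : ∃ q, i / D = q := ⟨_, rfl⟩
  rw [hq] at this ⊢
  omega

/-- The bounds of `rfNest`: `ℓ + 1 ≤ rfNest i < ℓ + 1 + D`. -/
theorem rfNest_bounds (ℓ D i : ℕ) (hD : 0 < D) : ℓ + 1 ≤ rfNest ℓ D i ∧ rfNest ℓ D i < ℓ + 1 + D := by
  unfold rfNest
  have := Nat.mod_lt i hD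
  omega

/-- The ends of the nested configuration are good (`0 < D ≤ t ≤ ℓ D`, `2 t ≤ s`). -/
theorem goodEnds_nest (s ℓ t D : ℕ) (hD : 0 < D) (hDt : D ≤ t) (htℓ : t ≤ ℓ * D) (hs : 2 * t ≤ s) :
    GoodEnds (ℓ + 1 + (s - t)) (ℓ + 1) t (lfNest D) (rfNest ℓ D) := by
  refine ⟨fun i hi => ?_, fun i _ => ?_, fun i i' _ _ h1 h2 => ?_⟩
  · have := lfNest_bounds t ℓ D i hD htℓ hi
    omega
  · have := rfNest_bounds ℓ D i hD
    omega
  · unfold lfNest at h1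
    unfold rfNest at h2
    have e1 := Nat.div_add_mod i D
    have e2 := Nat.div_add_mod i' D
    have h3 : i / D = i' / D := by omega
    have h4 : i % D = i' % D := by omega
    rw [h3, h4] at e1
    omega

/-- `coll t lfNest = m D (D − 1) + r (r − 1)` for `t = m D + r`, `r < D`. -/
theorem coll_lfNest (m r D : ℕ) (hD : 0 < D) (hr : r < D) :
    coll (m * D + r) (lfNest D) = m * (D * (D - 1)) + r * (r - 1) := by
  rw [coll_eq_sum_cls (m * D + r) (lfNest D) ((range (m + 1)).image (fun a => 1 + a)) (fun i hi => by
    rw [mem_image]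
    have hq : i / D < m + 1 := by
      rw [Nat.div_lt_iff_lt_mul hD]
      have : (m + 1) * D = m * D + D := by ring
      omega
    obtain ⟨q, hq'⟩ : ∃ q, i / D = q := ⟨_, rfl⟩
    rw [hq'] at hq
    refine ⟨q, mem_range.mpr hq, ?_⟩
    unfold lfNest
    rw [hq'])]
  rw [sum_image (fun a _ a' _ h => by omega), sum_range_succ]
  unfold cls
  rw [cls_lfNest_last m r D hD hr]
  congr 1
  rw [sum_const_nat (m := D * (D - 1)) (fun a ha => by rw [cls_lfNest_full m r D a hD (mem_range.mp ha)]), card_range]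

/-- `coll t rfNest = r (m + 1) m + (D − r) m (m − 1)` for `t = m D + r`, `r < D`. -/
theorem coll_rfNest (ℓ m r D : ℕ) (hD : 0 < D) (hr : r < D) :
    coll (m * D + r) (rfNest ℓ D) = r * ((m + 1) * m) + (D - r) * (m * (m - 1)) := by
  have hdiv : (m * D + r) / D = m := by
    rw [Nat.add_comm, Nat.add_mul_div_right _ _ hD, Nat.div_eq_of_lt hr, zero_add]
  have hmod : (m * D + r) % D = r := by
    rw [Nat.add_comm, Nat.add_mul_mod_self_right, Nat.mod_eq_of_lt hr]
  rw [coll_eq_sum_cls (m * D + r) (rfNest ℓ D) ((range D).image (fun b => ℓ + 1 + b)) (fun i _ => by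
    rw [mem_image]
    have := rfNest_bounds ℓ D i hD
    exact ⟨rfNest ℓ D i - (ℓ + 1), mem_range.mpr (by omega), by omega⟩)]
  rw [sum_image (fun b _ b' _ h => by omega)]
  have hcls : ∀ b ∈ range D, cls (m * D + r) (rfNest ℓ D) (ℓ + 1 + b) * (cls (m * D + r) (rfNest ℓ D) (ℓ + 1 + b) - 1) =
      if b < r then (m + 1) * m else m * (m - 1) := by
    intro b hb
    unfold cls
    rw [cls_rfNest _ _ _ _ hD (mem_range.mp hb), hdiv, hmod]
    split_ifs <;> simp
  rw [sum_congr rfl hcls, ← sum_range_add_sum_Ico _ (le_of_lt hr)]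
  congr 1
  · rw [sum_const_nat (m := (m + 1) * m) (fun b hb => by rw [if_pos (mem_range.mp hb)]), card_range]
  · rw [sum_const_nat (m := m * (m - 1)) (fun b hb => by rw [if_neg (by rw [mem_Ico] at hb; omega)]), Nat.card_Ico]

/-- **THE COLLISION COUNT OF THE NESTED CONFIGURATION:** `coll lf + coll rf + 2 t = sqNest m r D`. -/
theorem coll_nest_add (ℓ m r D : ℕ) (hD : 0 < D) (hr : r < D) :
    coll (m * D + r) (lfNest D) + coll (m * D + r) (rfNest ℓ D) + 2 * (m * D + r) = sqNest m r D := by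
  rw [coll_lfNest m r D hD hr, coll_rfNest ℓ m r D hD hr]
  unfold sqNest
  obtain ⟨e, he⟩ : ∃ e, D = r + e + 1 := ⟨D - r - 1, by omega⟩
  have hDr : D - r = e + 1 := by omega
  have hD1 : D - 1 = r + e := by omega
  rw [hDr, hD1]
  rcases m with _ | m
  · rcases r with _ | r
    · simp
    · rw [Nat.add_sub_cancel]
      ring
  · rw [Nat.add_sub_cancel]
    rcases r with _ | r
    · simp only [Nat.zero_mul, zero_add]
      subst he
      ring
    · rw [Nat.add_sub_cancel]
      subst he
      ring

/-- **THE BAND VALUE OF THE NESTED CONFIGURATION:** `t (t + 1) = sqNest m r D + m (D − 1) (D (m − 1) + 2 r)` for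
`t = m D + r`, `1 ≤ D` — the bottom `2 j = m (D − 1) (D (m − 1) + 2 r)`. -/
theorem two_mul_nest_bottom (m r D : ℕ) (hD : 1 ≤ D) :
    (m * D + r) * (m * D + r + 1) = sqNest m r D + m * (D - 1) * (D * (m - 1) + 2 * r) := by
  unfold sqNest
  obtain ⟨D', rfl⟩ : ∃ D', D = D' + 1 := ⟨D - 1, by omega⟩
  rcases m with _ | m
  · simp
  · simp only [Nat.add_sub_cancel]
    ring

/-- `sqMax t D ≤ t (t + 1)` for `1 ≤ D`. -/
theorem sqMax_le (t D : ℕ) (hD : 1 ≤ D) : sqMax t D ≤ t * (t + 1) := by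
  obtain ⟨m, r, hr, hsm⟩ : ∃ m r, r < D ∧ t = m * D + r :=
    ⟨t / D, t % D, Nat.mod_lt t hD, by have := Nat.div_add_mod t D; rw [mul_comm] at this; omega⟩
  rw [sqMax_eq t D m r hD hsm hr, hsm, two_mul_nest_bottom m r D hD]
  exact Nat.le_add_right _ _

/-- **THE NESTED WITNESS:** for `1 ≤ D ≤ t ≤ D²`, `t ≤ ℓ D`, `2 t ≤ s`, a triangle-free graph on `ℓ + 1 + (s − t)`
vertices with `s` edges, a vertex `w` of degree `s − t`, every off-degree `≤ D`, a non-neighbour of off-degree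
exactly `D`, and the band value `2 j = t (t + 1) − sqMax t D`. -/
theorem nestedWitness (s ℓ t D : ℕ) (hD : 1 ≤ D) (hDt : D ≤ t) (htD : t ≤ D * D) (htℓ : t ≤ ℓ * D)
    (hs : 2 * t ≤ s) :
    ∃ (H : SimpleGraph (Fin (ℓ + 1 + (s - t)))) (_ : DecidableRel H.Adj), H.CliqueFree 3 ∧
      H.edgeFinset.card = s ∧ ∃ w, deg H w + t = s ∧ (∀ v, offDeg H w v ≤ D) ∧
        (∃ x, ¬ H.Adj w x ∧ offDeg H w x = D) ∧
        ∑ v, deg H v * deg H v + 2 * (t * (s - t - 1)) + (t * (t + 1) - sqMax t D) = s * (s + 1) := by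
  obtain ⟨m, r, hr, hsm⟩ : ∃ m r, r < D ∧ t = m * D + r :=
    ⟨t / D, t % D, Nat.mod_lt t hD, by have := Nat.div_add_mod t D; rw [mul_comm] at this; omega⟩
  have hm : 1 ≤ m := by
    rcases Nat.eq_zero_or_pos m with rfl | h
    · omega
    · exact h
  have hmD : m ≤ D := by
    by_contra h
    have : (D + 1) * D ≤ m * D := Nat.mul_le_mul_right D (by omega)
    nlinarith
  have hℓ : 1 ≤ ℓ := by
    rcases Nat.eq_zero_or_pos ℓ with h | h
    · subst h
      simp at htℓ
      omega
    · exact h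
  set n := ℓ + 1 + (s - t) with hn
  have hn0 : 0 < n := by omega
  have ht0 : 0 < t := by omega
  have hg := goodEnds_nest s ℓ t D hD hDt htℓ hs
  have hval := genWitness_missing_value n (ℓ + 1) s t hn0 (lfNest D) (rfNest ℓ D) hg (by omega) ht0 (by omega)
    (by omega)
  have hatt : ((range t).filter (fun i => rfNest ℓ D i < ℓ + 1 + (s - t))).card = t := by
    rw [filter_true_of_mem (fun i _ => by
      have := rfNest_bounds ℓ D i hD
      omega), card_range]
  have hcoll := coll_nest_add ℓ m r D hD hr
  rw [← hsm] at hcoll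
  have hbot := two_mul_nest_bottom m r D hD
  rw [← hsm] at hbot
  have hsq : sqMax t D = sqNest m r D := sqMax_eq t D m r hD hsm hr
  rw [hatt, Nat.sub_self, mul_zero, zero_add] at hval
  have hP : t * (t - 1) - (coll t (lfNest D) + coll t (rfNest ℓ D)) = t * (t + 1) - sqMax t D := by
    have e1 : t * (t + 1) = t * (t - 1) + 2 * t := by
      obtain ⟨t', rfl⟩ : ∃ t', t = t' + 1 := ⟨t - 1, by omega⟩
      rw [Nat.add_sub_cancel]
      ring
    rw [hsq]
    omega
  rw [hP] at hval
  refine ⟨_, inferInstance, cliqueFree_of_bipSub _ _ (bipSub_missingGraph _ _),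
    card_edges_missingGraph_genWitness n (ℓ + 1) s t hn0 (lfNest D) (rfNest ℓ D) hg (by omega) (by omega)
      (by omega), fin' n hn0 0, ?_, ?_, ?_, hval⟩
  · rw [deg_missingGraph_genWitness_zero n (ℓ + 1) s t hn0 (lfNest D) (rfNest ℓ D) hg (by omega) (by omega)]
    omega
  · intro v
    have hv : v = fin' n hn0 v.val := Fin.ext (by rw [fin'_val n hn0 v.val v.isLt])
    rw [hv]
    by_cases hva : v.val < ℓ + 1
    · rw [offDeg_genWitness_left n (ℓ + 1) s t hn0 (lfNest D) (rfNest ℓ D) hg (by omega) v.val hva]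
      by_cases hv1 : 1 ≤ v.val
      · obtain ⟨a, ha⟩ : ∃ a, v.val = 1 + a := ⟨v.val - 1, by omega⟩
        rw [ha, cls_lfNest t D a hD]
        exact min_le_left _ _
      · rw [card_eq_zero.mpr (filter_eq_empty_iff.mpr (fun i hi hv' => by
          rw [mem_range] at hi
          have := lfNest_bounds t ℓ D i hD htℓ hi
          omega))]
        omega
    · rw [offDeg_genWitness_right n (ℓ + 1) s t hn0 (lfNest D) (rfNest ℓ D) hg (by omega) v.val (by omega) v.isLt]
      by_cases hvb : v.val < ℓ + 1 + D
      · obtain ⟨b, hb⟩ : ∃ b, v.val = ℓ + 1 + b := ⟨v.val - (ℓ + 1), by omega⟩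
        rw [hb, cls_rfNest t ℓ D b hD (by omega)]
        have hdiv : t / D = m := by
          rw [hsm, Nat.add_comm, Nat.add_mul_div_right _ _ hD, Nat.div_eq_of_lt hr, zero_add]
        rw [hdiv]
        split_ifs with hbr
        · -- `m + 1 ≤ D`: `r > 0` forces `m < D`
          have hmod : t % D = r := by
            rw [hsm, Nat.add_comm, Nat.add_mul_mod_self_right, Nat.mod_eq_of_lt hr]
          rw [hmod] at hbr
          have hmlt : m < D := by
            by_contra h
            have hmD' : m = D := le_antisymm hmD (by omega)
            subst hmD'
            nlinarith
          omega
        · omega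
      · rw [card_eq_zero.mpr (filter_eq_empty_iff.mpr (fun i _ hv' => by
          have := rfNest_bounds ℓ D i hD
          omega))]
        omega
  · refine ⟨fin' n hn0 1, not_adj_genWitness_one n (ℓ + 1) s t hn0 (lfNest D) (rfNest ℓ D) (by omega) (by omega),
      ?_⟩
    rw [offDeg_genWitness_left n (ℓ + 1) s t hn0 (lfNest D) (rfNest ℓ D) hg (by omega) 1 (by omega)]
    have := cls_lfNest_full m r D 0 hD hm
    rw [add_zero, ← hsm] at this
    exact this

/-- **THE EXACT BOTTOM OF THE DEEP SUB-BAND IN THE NESTED REGIME, EVERY `ℓ`:** for `1 ≤ D ≤ t ≤ D²`, `t ≤ ℓ D`,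
`2 t ≤ s`, every graph on `ℓ + 1 + (s − t)` vertices with a vertex of degree `s − t` and every off-degree `≤ D`
has `t (t + 1) ≤ 2 j + sqMax t D`, and the nested configuration attains `2 j = t (t + 1) − sqMax t D` with
maximum off-degree exactly `D`: the bottom of the sub-band `u = t − D` is `(t (t + 1) − sqMax t D) / 2`. -/
theorem nested_bottom_exact (s t ℓ D : ℕ) (hD : 1 ≤ D) (hDt : D ≤ t) (htD : t ≤ D * D) (htℓ : t ≤ ℓ * D)
    (hs : 2 * t ≤ s) :
    (∀ (H : SimpleGraph (Fin (ℓ + 1 + (s - t)))) [DecidableRel H.Adj], H.CliqueFree 3 →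
      H.edgeFinset.card = s → ∀ w, deg H w + t = s → (∀ v, offDeg H w v ≤ D) →
      ∀ j, ∑ v, deg H v * deg H v + 2 * (t * (s - t - 1)) + 2 * j = s * (s + 1) →
      t * (t + 1) ≤ 2 * j + sqMax t D) ∧
    (∃ (H : SimpleGraph (Fin (ℓ + 1 + (s - t)))) (_ : DecidableRel H.Adj), H.CliqueFree 3 ∧
      H.edgeFinset.card = s ∧ ∃ w, deg H w + t = s ∧ (∀ v, offDeg H w v ≤ D) ∧
        (∃ x, ¬ H.Adj w x ∧ offDeg H w x = D) ∧
        ∑ v, deg H v * deg H v + 2 * (t * (s - t - 1)) + (t * (t + 1) - sqMax t D) = s * (s + 1)) := by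
  refine ⟨fun H _ hfree hsH w hw hD' j hj => ?_, nestedWitness s ℓ t D hD hDt htD htℓ hs⟩
  have hw1 : 1 ≤ deg H w := by omega
  exact band_ge_nested H hfree s t j D hsH w hw hw1 hj hD' htD

end C047

end TriangleCap

end PercRepro
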